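import Summits.ValiantsHypothesis.ValiantsHypothesis.Theorems.LacunarySymmetroidMatrixDescartesCensusDoorA34RootWitness

/-!
# `MatrixDescartes` census — DOOR A at `(3,4)`: the rank-one form of the adjugate at a root, and KERNEL LINES VERSUS PLANES
# (at most nine roots have their kernel line in a given plane)

HONEST FRAMING.  Object-search cell `pub-symmetroid`, route `LacunarySymmetroid`; beside the OPEN typed statement
`Theses.LacunarySymmetroid.DoorA34` (stmt-ValiantsHypothesis-19980, `= DoorA34 = PosRootLawAt 3 4 18`), asserted nowhere.  Part of the ROOT LAYER of a
hypothetical `(3,4)` nineteen (`…RootRank`, `…RootType`, `…RootWitness`).  For ALL supports and with NO definiteness hypothesis: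

* `adjugate_smul_eq_of_mulVec_eq_zero` — for a real symmetric `3 × 3` matrix `A` and a vector `u` with `A u = 0`:
  `|u|² · adj A = (tr adj A) · u uᵀ` (the adjugate of a singular symmetric matrix is the rank-one form on its kernel line; an explicit
  `linear_combination` of the three relations `(A u)_i = 0`, found by Gröbner-free linear algebra and checked by `ring`).
* `quadForm_adjugate_eq_zero_of_kernel_orthogonal` — hence `cᵀ adj A c = 0` for every direction `c ⊥ u` (`u ≠ 0`): the dual conic of a line pair
  vanishes on the lines through its vertex.
* **`card_roots_kernel_orthogonal_le_nine`** — for a real symmetric `(3,4)` pencil and a direction `c` whose form `Σ c_i c_j (adj P)_{ij}` (the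
  `10`-nomial of `…RootWitness`) is not the zero polynomial: AT MOST NINE positive det-roots `r` admit a kernel vector `u ≠ 0`, `P(r) u = 0`, with
  `c ⊥ u` — at most nine of the kernel lines of a nineteen lie in any given plane through the origin (companion of `…KernelLines`: at most three coincide).

NOTHING here bounds `ζ_sym(3,4)`; `DoorA34` stays OPEN; nothing bears on `MatrixDescartes` (stmt-ValiantsHypothesis-18050) or on `VP ≠ VNP`.
[folklore] Linear algebra of `3 × 3` symmetric matrices + sparse Descartes; no citation is needed.
-/

-- `Summit.ValiantsHypothesis.ValiantsHypothesis.…` repeats a component by the D-0017 layout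
-- (single-conjunct summit), which the `dupNamespace` linter flags; the name is mandated.
set_option linter.dupNamespace false

namespace Summit.ValiantsHypothesis.ValiantsHypothesis.Theorems.LacunarySymmetroidMatrixDescartes.Census

open Polynomial Finset
open scoped BigOperators Polynomial Matrix

/-- **Rank-one form of the adjugate on the kernel line.**  For a real symmetric `3 × 3` matrix `A` and `u` with `A u = 0`:
`(u ⬝ u) • adj A = (tr adj A) • u uᵀ`. [folklore] -/
theorem adjugate_smul_eq_of_mulVec_eq_zero {A : Matrix (Fin 3) (Fin 3) ℝ} (hA : A.IsSymm) {u : Fin 3 → ℝ}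
    (hu : A *ᵥ u = 0) : (u ⬝ᵥ u) • A.adjugate = A.adjugate.trace • Matrix.vecMulVec u u := by
  have hs : ∀ i j, A j i = A i j := fun i j => by
    have := congrFun (congrFun hA i) j
    simpa [Matrix.transpose_apply] using this
  have h0 : A 0 0 * u 0 + A 0 1 * u 1 + A 0 2 * u 2 = 0 := by
    have := congrFun hu 0
    simpa [Matrix.mulVec, dotProduct, Fin.sum_univ_three] using this
  have h1 : A 0 1 * u 0 + A 1 1 * u 1 + A 1 2 * u 2 = 0 := by
    have := congrFun hu 1
    simpa [Matrix.mulVec, dotProduct, Fin.sum_univ_three, hs 0 1] using this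
  have h2 : A 0 2 * u 0 + A 1 2 * u 1 + A 2 2 * u 2 = 0 := by
    have := congrFun hu 2
    simpa [Matrix.mulVec, dotProduct, Fin.sum_univ_three, hs 0 2, hs 1 2] using this
  ext a b
  fin_cases a <;> fin_cases b <;>
    simp only [Matrix.smul_apply, smul_eq_mul, Matrix.adjugate_fin_three, Matrix.trace_fin_three, Matrix.vecMulVec_apply,
      dotProduct, Fin.sum_univ_three, Matrix.of_apply, Matrix.cons_val', Matrix.cons_val_zero, Matrix.cons_val_one,
      Matrix.cons_val_two, Matrix.empty_val', Matrix.cons_val_fin_one, Matrix.head_cons, Matrix.tail_cons,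
      Matrix.head_fin_const, Fin.isValue, Fin.zero_eta, Fin.mk_one, Fin.reduceFinMk, hs 0 1, hs 0 2, hs 1 2]
  -- entry (0,0)
  · linear_combination (-A 2 2 * u 0 - A 1 1 * u 0) * h0 + (A 2 2 * u 1 - A 1 2 * u 2 + A 0 1 * u 0) * h1 + (-A 1 2 * u 1 + A 1 1 * u 2 + A 0 2 * u 0) * h2
  -- entry (0,1)
  · linear_combination (-A 2 2 * u 1 + A 1 2 * u 2 + A 0 1 * u 0) * h0 + (-A 2 2 * u 0 - A 0 0 * u 0) * h1 + (A 1 2 * u 0 + A 0 2 * u 1 - A 0 1 * u 2) * h2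
  -- entry (0,2)
  · linear_combination (A 1 2 * u 1 - A 1 1 * u 2 + A 0 2 * u 0) * h0 + (A 1 2 * u 0 - A 0 2 * u 1 + A 0 1 * u 2) * h1 + (-A 1 1 * u 0 - A 0 0 * u 0) * h2
  -- entry (1,0)
  · linear_combination (-A 2 2 * u 1 + A 1 2 * u 2 + A 0 1 * u 0) * h0 + (-A 2 2 * u 0 - A 0 0 * u 0) * h1 + (A 1 2 * u 0 + A 0 2 * u 1 - A 0 1 * u 2) * h2
  -- entry (1,1)
  · linear_combination (A 2 2 * u 0 - A 0 2 * u 2 + A 0 1 * u 1) * h0 + (-A 2 2 * u 1 - A 0 0 * u 1) * h1 + (A 1 2 * u 1 - A 0 2 * u 0 + A 0 0 * u 2) * h2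
  -- entry (1,2)
  · linear_combination (-A 1 2 * u 0 + A 0 2 * u 1 + A 0 1 * u 2) * h0 + (A 1 2 * u 1 + A 0 2 * u 0 - A 0 0 * u 2) * h1 + (-A 1 1 * u 1 - A 0 0 * u 1) * h2
  -- entry (2,0)
  · linear_combination (A 1 2 * u 1 - A 1 1 * u 2 + A 0 2 * u 0) * h0 + (A 1 2 * u 0 - A 0 2 * u 1 + A 0 1 * u 2) * h1 + (-A 1 1 * u 0 - A 0 0 * u 0) * h2
  -- entry (2,1)
  · linear_combination (-A 1 2 * u 0 + A 0 2 * u 1 + A 0 1 * u 2) * h0 + (A 1 2 * u 1 + A 0 2 * u 0 - A 0 0 * u 2) * h1 + (-A 1 1 * u 1 - A 0 0 * u 1) * h2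
  -- entry (2,2)
  · linear_combination (A 1 1 * u 0 + A 0 2 * u 2 - A 0 1 * u 1) * h0 + (A 1 2 * u 2 - A 0 1 * u 0 + A 0 0 * u 1) * h1 + (-A 1 1 * u 2 - A 0 0 * u 2) * h2

/-- **The dual conic of a line pair vanishes on the lines through its vertex.**  For a real symmetric `3 × 3` matrix `A`, a kernel vector
`u ≠ 0` (`A u = 0`) and any `c ⊥ u`: `cᵀ adj A c = 0`. [folklore] -/
theorem quadForm_adjugate_eq_zero_of_kernel_orthogonal {A : Matrix (Fin 3) (Fin 3) ℝ} (hA : A.IsSymm) {u c : Fin 3 → ℝ}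
    (hu : u ≠ 0) (hAu : A *ᵥ u = 0) (hc : c ⬝ᵥ u = 0) : c ⬝ᵥ (A.adjugate *ᵥ c) = 0 := by
  have key := adjugate_smul_eq_of_mulVec_eq_zero hA hAu
  have h := congrArg (fun M : Matrix (Fin 3) (Fin 3) ℝ => c ⬝ᵥ (M *ᵥ c)) key
  simp only [Matrix.smul_mulVec, dotProduct_smul, smul_eq_mul] at h
  have hv : Matrix.vecMulVec u u *ᵥ c = (u ⬝ᵥ c) • u := by
    funext i
    simp [Matrix.mulVec, Matrix.vecMulVec_apply, dotProduct, Finset.mul_sum, Pi.smul_apply, smul_eq_mul, mul_comm,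
      mul_left_comm]
  rw [hv, dotProduct_smul, smul_eq_mul, dotProduct_comm u c, hc] at h
  simp only [mul_zero] at h
  rcases mul_eq_zero.mp h with h0 | h0
  · -- `u ⬝ u = 0` forces `u = 0`
    exfalso; apply hu
    have h' : u 0 * u 0 + u 1 * u 1 + u 2 * u 2 = 0 := by simpa [dotProduct, Fin.sum_univ_three] using h0
    have e0 : u 0 = 0 := by nlinarith [sq_nonneg (u 0), sq_nonneg (u 1), sq_nonneg (u 2)]
    have e1 : u 1 = 0 := by nlinarith [sq_nonneg (u 0), sq_nonneg (u 1), sq_nonneg (u 2)]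
    have e2 : u 2 = 0 := by nlinarith [sq_nonneg (u 0), sq_nonneg (u 1), sq_nonneg (u 2)]
    funext i; fin_cases i <;> simp [e0, e1, e2]
  · exact h0

/-- **AT MOST NINE ROOTS HAVE THEIR KERNEL LINE IN A GIVEN PLANE.**  Let `P = Σ_l X^{d l} S_l` have real symmetric `3 × 3` letters (any support)
and let `c` be a direction whose form `g_c = Σ_{i,j} c_i c_j (adj P)_{ij}` is not the zero polynomial.  If `T` is a finite set of positive
det-roots each admitting a kernel vector `u ≠ 0` with `P(r) u = 0` and `c ⊥ u`, then `#T ≤ 9`: each such `r` is a positive root of the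
`10`-nomial `g_c` (`…RootWitness`). [folklore] -/
theorem card_roots_kernel_orthogonal_le_nine (d : Fin 4 → ℕ) (S : Fin 4 → Matrix (Fin 3) (Fin 3) ℝ) (hS : ∀ l, (S l).IsSymm)
    (c : Fin 3 → ℝ) (hg : (∑ i, ∑ j, C (c i * c j) * (∑ l, ((X : ℝ[X]) ^ d l) • (S l).map C).adjugate i j) ≠ 0)
    (T : Finset ℝ) (hT : ∀ r ∈ T, 0 < r)
    (hker : ∀ r ∈ T, ∃ u : Fin 3 → ℝ, u ≠ 0 ∧ (∑ l, r ^ d l • S l) *ᵥ u = 0 ∧ c ⬝ᵥ u = 0) : T.card ≤ 9 := by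
  set g := ∑ i, ∑ j, C (c i * c j) * (∑ l, ((X : ℝ[X]) ^ d l) • (S l).map C).adjugate i j with hgdef
  have h1 := Literature.Computability.AlgebraicComplexity.card_roots_toFinset_filter_pos_lt_card_support hg
  have h2 : g.support.card ≤ 10 :=
    (Finset.card_le_card (support_quadForm_adjugate_pencil_subset d S c)).trans (card_pairSums_four_le d)
  have h3 : T ⊆ g.roots.toFinset.filter (0 < ·) := by
    intro r hr
    obtain ⟨u, hu, hPu, hcu⟩ := hker r hr
    rw [Finset.mem_filter, Multiset.mem_toFinset, Polynomial.mem_roots hg]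
    refine ⟨?_, hT r hr⟩
    rw [Polynomial.IsRoot.def, hgdef, eval_quadForm_adjugate_pencil]
    exact quadForm_adjugate_eq_zero_of_kernel_orthogonal (isSymm_pencil_eval d hS r) hu hPu hcu
  have h4 := Finset.card_le_card h3
  omega

end Summit.ValiantsHypothesis.ValiantsHypothesis.Theorems.LacunarySymmetroidMatrixDescartes.Census
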